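import Literature.NumberTheory.Automorphic.RankinSelbergLocal
import Literature.NumberTheory.Automorphic.IrreducibleClasses
import HarnessLib

/-!
# Named fact: non-supercuspidal generic representations of `GL₂(F)` have a twist with non-trivial
Rankin–Selberg `L`-factor (Bump 1997, §4.7; Jacquet–Langlands 1970, Props. 3.5–3.6)

Vendored for the rank-2 step of the rigidity line `Sketch_18745_r1_k1` (crux
`DyadicOddResidue.SectorComplement`, stmt-Langlands-18745), where it is the one external input:
the Galois parameter of a generic non-supercuspidal `π` must have SOME non-trivial twisted Euler
factor.  Bump 1997, §4.7: every irreducible admissible `π` of `GL₂(F)` with a Whittaker model is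
supercuspidal (Jacquet module `J(V) = 0`), an irreducible principal series `π(χ₁, χ₂)` or a special
representation `σ(χ₁, χ₂)` (Prop. 4.7.1 with §4.5); `L(s, π) = 1`, `(1 - α₁q^{-s})⁻¹(1 - α₂q^{-s})⁻¹`,
`(1 - α₂q^{-s})⁻¹` respectively, `α_i = χ_i(ϖ)` for unramified `χ_i` and `0` otherwise
((7.9)–(7.10)); `L(s, π, ξ) := L(s, ξ ⊗ π)`; and `L(s, π, ξ)⁻¹`-normalised zeta integrals
`Z(s, φ, ξ) = ∫ φ(y) ξ(y) |y|^{s-1/2} d^×y` of the Kirillov model generate exactly `L(s, π, ξ)`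
(Prop. 4.7.5).  Hence for `π` not supercuspidal some twist `ξ` (e.g. `χ₂⁻¹`) has
`L(s, π, ξ) ≠ 1`.  In the tree's vocabulary the `Z(s, φ, ξ)` are the JPSS zeta integrals of
`HasRSLFactor` at `(n, m) = (2, 1)` against `glOneRep ξ`, and "supercuspidal" is Harish-Chandra's
`Representation.IsSupercuspidal` (= `J(V) = 0` by `isSupercuspidal_iff_jacquetGL_holds`).
-/

noncomputable section

open scoped MatrixGroups Polynomial
open MeasureTheory

namespace Literature.NumberTheory.Automorphic

/-- **Non-supercuspidal generic representations of `GL₂(F)` have a twist with non-trivial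
Rankin–Selberg `L`-factor** (Bump 1997, §4.7: every irreducible admissible `π` with a Whittaker
model is supercuspidal, an irreducible principal series `π(χ₁, χ₂)` or special `σ(χ₁, χ₂)`
(Prop. 4.7.1 and §4.5), with `L(s, π) = 1`, `(1 - α₁q^{-s})⁻¹(1 - α₂q^{-s})⁻¹`,
`(1 - α₂ q^{-s})⁻¹` respectively, `α_i = χ_i(ϖ)` for unramified `χ_i` and `0` otherwise
((7.9)–(7.10)), `L(s, π, ξ) := L(s, ξ ⊗ π)`, and `L(s, π, ξ)` is the g.c.d. of the zeta integrals
`Z(s, φ, ξ) = ∫ φ(y) ξ(y) |y|^{s-1/2} d^×y` of the Kirillov model (Prop. 4.7.5) — so for `π` not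
supercuspidal the twist `ξ := χ₂⁻¹` gives `L(s, π, ξ) ≠ 1`; Jacquet–Langlands 1970, Props. 3.5–3.6).
Rendered in the tree's vocabulary: the JPSS `L`-polynomial `P` (`HasRSLFactor` at
`(n, m) = (2, 1)`, whose zeta integrals ARE the `Z(s, φ, ξ)` above) of `(π, ξ ∘ det)` is `≠ 1`
for some quasi-character `ξ`, for every invariant Radon measure on `GL₁(F) ⧸ U₁`; "supercuspidal"
is Harish-Chandra's notion `Representation.IsSupercuspidal` (= `J(V) = 0`, Bump's definition, by
the tree's `isSupercuspidal_iff_jacquetGL_holds`). Named fact (D-0014).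
[cite: Bump1997, §4.7 (7.9)–(7.10), Prop. 4.7.1, Prop. 4.7.5]
[cite: JacquetLanglands1970, Props. 3.5–3.6]
-/
def Bump1997_gl2_exists_twist_rsLFactor_ne_one : Prop :=
  ∀ (F : Type) [Field F] [ValuativeRel F] [TopologicalSpace F] [IsNonarchimedeanLocalField F]
    (π : SmoothIrrep (GL (Fin 2) F)) (ψ : AddChar F Circle), ψ.IsContinuousNontrivial →
    IsGeneric π.ρ ψ → ¬ π.ρ.IsSupercuspidal →
    ∃ ξ : QuasiChar F, ∀ [MeasurableSpace (GL (Fin 1) F ⧸ upperUnitriangular (Fin 1) F)]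
      [BorelSpace (GL (Fin 1) F ⧸ upperUnitriangular (Fin 1) F)]
      (ν : Measure (GL (Fin 1) F ⧸ upperUnitriangular (Fin 1) F))
      [SMulInvariantMeasure (GL (Fin 1) F) (GL (Fin 1) F ⧸ upperUnitriangular (Fin 1) F) ν]
      [IsFiniteMeasureOnCompacts ν] [ν.IsOpenPosMeasure] (P : ℂ[X]),
      HasRSLFactor Nat.one_lt_two π.ρ (glOneRep (ξ : Fˣ →* ℂˣ)) ψ ν P → P ≠ 1


end Literature.NumberTheory.Automorphic

end
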